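import Mathlib

/-!
# Route `FordMaynardSieveConst01651`, target `SieveConst01651` (stmt-Parity-19185), line `sieve_decomposition`:
# helpers towards `stub_typeIIRegion` — counting integers with a large square factor

Ford–Maynard, arXiv:2407.14368v1, §7: the expansion of `H(n)` by index sets `J ⊆ [k]` (proof of Proposition 7.22,
p. 40) and Lemma 7.18 (a) are stated for `n₂ = p₁⋯p_k` as if squarefree; integers `n ≤ x` with a square factor
`p² ∣ n`, `p > y` large, are few — `#{n ≤ X : ∃ p > Y prime, p² ∣ n} ≤ ∑_{p > Y} X/p² ≤ 2X/(Y+1)` — and their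
`|w|`-mass is then discarded with `…TypeIMass` / `…BilinMass`.  This file proves the count (the skeleton's
`card_NSFset_le` is the special case of rough `n`; a `Lines` module is not importable).
* `card_filter_exists_sq_dvd_le_sum` — union bound over the primes `p ∈ (Y, X]`;
* `card_filter_exists_sq_dvd_le` — `#{n ∈ [1, X] : ∃ p prime, Y < p, p² ∣ n} ≤ 2X/(Y+1)` (Mathlib `sum_Ioo_inv_sq_le`).
Def-free. Nothing here proves anything about the Parity summit. [folklore; cf. FM §7.2 for the set 𝒩]
-/

open Finset

namespace Summit.Parity.GeneralizedHardyLittlewood.FordMaynardSieveConst01651SieveConst01651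

open scoped Classical in
/-- Union bound: `#{n ∈ [1,X] : ∃ p prime, Y < p, p² ∣ n} ≤ ∑_{p ∈ (Y, X], p prime} ⌊X/p²⌋`. [folklore] -/
theorem card_filter_exists_sq_dvd_le_sum (X Y : ℕ) :
    ((Icc 1 X).filter (fun n => ∃ p : ℕ, p.Prime ∧ Y < p ∧ p ^ 2 ∣ n)).card ≤
      ∑ p ∈ (Ioc Y X).filter Nat.Prime, X / p ^ 2 := by
  calc ((Icc 1 X).filter (fun n => ∃ p : ℕ, p.Prime ∧ Y < p ∧ p ^ 2 ∣ n)).card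
      ≤ (((Ioc Y X).filter Nat.Prime).biUnion (fun p => (Icc 1 X).filter (fun n => p ^ 2 ∣ n))).card := by
        refine Finset.card_le_card fun n hn => ?_
        rw [Finset.mem_filter, Finset.mem_Icc] at hn
        obtain ⟨⟨hn1, hnX⟩, p, hp, hYp, hdvd⟩ := hn
        rw [Finset.mem_biUnion]
        refine ⟨p, ?_, ?_⟩
        · rw [Finset.mem_filter, Finset.mem_Ioc]
          refine ⟨⟨hYp, ?_⟩, hp⟩
          have hp2 : p ^ 2 ≤ n := Nat.le_of_dvd (by omega) hdvd
          nlinarith [hp.one_lt]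
        · rw [Finset.mem_filter, Finset.mem_Icc]
          exact ⟨⟨hn1, hnX⟩, hdvd⟩
    _ ≤ ∑ p ∈ (Ioc Y X).filter Nat.Prime, ((Icc 1 X).filter (fun n => p ^ 2 ∣ n)).card :=
        Finset.card_biUnion_le
    _ = ∑ p ∈ (Ioc Y X).filter Nat.Prime, X / p ^ 2 := by
        refine Finset.sum_congr rfl fun p _ => ?_
        rw [← Nat.Ioc_filter_dvd_card_eq_div X (p ^ 2)]
        congr 1

open scoped Classical in
/-- **Few integers have a large square factor**: `#{n ∈ [1, X] : ∃ p prime, Y < p, p² ∣ n} ≤ 2X/(Y+1)`.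
[folklore] -/
theorem card_filter_exists_sq_dvd_le (X Y : ℕ) :
    (((Icc 1 X).filter (fun n => ∃ p : ℕ, p.Prime ∧ Y < p ∧ p ^ 2 ∣ n)).card : ℝ) ≤
      2 * (X : ℝ) / ((Y : ℝ) + 1) := by
  have h1 : (((Icc 1 X).filter (fun n => ∃ p : ℕ, p.Prime ∧ Y < p ∧ p ^ 2 ∣ n)).card : ℝ) ≤
      ∑ p ∈ (Ioc Y X).filter Nat.Prime, ((X / p ^ 2 : ℕ) : ℝ) := by
    exact_mod_cast card_filter_exists_sq_dvd_le_sum X Y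
  refine h1.trans ?_
  calc ∑ p ∈ (Ioc Y X).filter Nat.Prime, ((X / p ^ 2 : ℕ) : ℝ)
      ≤ ∑ p ∈ (Ioc Y X).filter Nat.Prime, (X : ℝ) * ((p : ℝ) ^ 2)⁻¹ := by
        refine Finset.sum_le_sum fun p hp => ?_
        have hp0 : (0 : ℝ) < (p : ℝ) ^ 2 := by
          have := (Finset.mem_filter.mp hp).2.pos
          positivity
        rw [← div_eq_mul_inv, le_div_iff₀ hp0]
        exact_mod_cast Nat.div_mul_le_self X (p ^ 2)
    _ ≤ ∑ p ∈ Ioo Y (X + 1), (X : ℝ) * ((p : ℝ) ^ 2)⁻¹ := by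
        refine Finset.sum_le_sum_of_subset_of_nonneg ?_ fun p _ _ => by positivity
        intro p hp
        rw [Finset.mem_filter, Finset.mem_Ioc] at hp
        rw [Finset.mem_Ioo]
        omega
    _ = (X : ℝ) * ∑ p ∈ Ioo Y (X + 1), ((p : ℝ) ^ 2)⁻¹ := by rw [Finset.mul_sum]
    _ ≤ (X : ℝ) * (2 / ((Y : ℝ) + 1)) :=
        mul_le_mul_of_nonneg_left (sum_Ioo_inv_sq_le Y (X + 1)) (Nat.cast_nonneg _)
    _ = 2 * (X : ℝ) / ((Y : ℝ) + 1) := by ring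

end Summit.Parity.GeneralizedHardyLittlewood.FordMaynardSieveConst01651SieveConst01651
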